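import Summits.BirchSwinnertonDyer.BirchSwinnertonDyer.Theorems.SylvesterTwoHeegnerIndexCoupledTelescopeStep
import HarnessLib

/-!
# The COUPLED Cassels–Tate telescope, X-d: the ISOTROPY conjuncts of hT^κ for the pull-back pairing,
# from the lifts' images in the isotropic `𝒪`-stable `D` (generic-witness form; pure algebra)

Crux `UpperOffV0HSYPlus` (stmt-BirchSwinnertonDyer-19804); census theorems p704180 / p704241 (display
hT^κ, isotropy conjuncts `∀ i i', Odd i → Odd i' → P_A ⟨sA i, _⟩ ⟨sA i', _⟩ = 0 ∧ P_A ⟨wA (sA i), _⟩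
⟨sA i', _⟩ = 0` and the even/`B` twin).  Inputs already in the tree: the lifts' IMAGES IN `D`
(`…LiftPackage.exists_lift_family` / `…LiftInterleave.interleaved_lift_clauses`, outputs 10–11:
`τ (s i) = ι a`, `τ (wS (s i)) = ι (wM a)`, `a ∈ D`), the ISOTROPY of `D = closure (r(L) ∪ wM '' r(L))`
(`…LagrangianPackage.exists_coisotropic_lagrangian_of_package`, p701264), and the Selmer-to-`Ш[2^∞]`
map `ι₂` over `torsionH1ToH1` (p700609 `exists_selmerToPrimaryComponent`).  The rows DEFINE the
sesquilinear pull-back pairing `P s t := (B₂ (ι₂ s) (ι₂ t), B₂ (ι₂ s) (wM (ι₂ t)))` (memo two §59.1 (i));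
here that definition enters as an EQUATION on a binder `P` (planner D586: generic-witness form), and
the file proves:

* `w_mem_closure_union_image` — `D = closure (T ∪ wM '' T)` is `wM`-stable when `wM² = -1 - wM`;
* `isotropy_of_images` — for every family `s` with images in `D`:
  `P ⟨s i, _⟩ ⟨s i', _⟩ = 0 ∧ P ⟨wS (s i), _⟩ ⟨s i', _⟩ = 0` for all `i, i'` (hT^κ's l.209–212 minus the
  idle parity antecedents).

Abstract groups `S` (for `H¹(K, X[n])`), `M` (for `Ш(X_K)[2^∞]`), `Q` (for `H¹(K, X)`), `R` (values);
theorem-only (no definition, no named fact); nothing asserted on 19804; no stub closed; BSD not claimed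
for any curve.  Sources: McCallum 1991 §5 (p. 288: `D` isotropic, the lifts `c_i`); MEMO-bsd-cm-two
§59.1 (i) (sesquilinear refinement), §64.5.
-/

-- every Summits module is named `Summit.<Summit>.<Problem>…`: the duplicated component is by design
set_option linter.dupNamespace false
set_option autoImplicit false

namespace Summit.BirchSwinnertonDyer.BirchSwinnertonDyer.Theorems.SylvesterTwoCoupledTelescope

section LiftIsotropy

variable {S M Q R : Type*} [AddCommGroup S] [AddCommGroup M] [AddCommGroup Q] [AddCommGroup R]

/-- **`𝒪`-stability of an `𝒪`-span**: if `wM (wM x) = -x - wM x` then `closure (T ∪ wM '' T)` is stable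
under `wM`. [folklore] -/
theorem w_mem_closure_union_image (wM : M →+ M) (hw : ∀ x, wM (wM x) = -x - wM x) (T : Set M)
    {a : M} (ha : a ∈ AddSubgroup.closure (T ∪ wM '' T)) :
    wM a ∈ AddSubgroup.closure (T ∪ wM '' T) := by
  induction ha using AddSubgroup.closure_induction with
  | mem u hu =>
    rcases hu with hu | ⟨v, hv, rfl⟩
    · exact AddSubgroup.subset_closure (Set.mem_union_right _ (Set.mem_image_of_mem wM hu))
    · rw [hw]
      exact AddSubgroup.sub_mem _
        (AddSubgroup.neg_mem _ (AddSubgroup.subset_closure (Set.mem_union_left _ hv)))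
        (AddSubgroup.subset_closure (Set.mem_union_right _ (Set.mem_image_of_mem wM hv)))
  | zero => rw [map_zero]; exact zero_mem _
  | add u v _ _ hu hv => rw [map_add]; exact add_mem hu hv
  | neg u _ hu => rw [map_neg]; exact neg_mem hu

/-- **hT^κ's isotropy conjuncts for the pull-back pairing** (generic-witness form): with
`ι₂ : Sel →+ M` over `τ` modulo the injection `ι` (p700609's `exists_selmerToPrimaryComponent`), an
`𝒪`-stable isotropic `D = closure (T ∪ wM '' T)` for `B₂`, the sesquilinear pull-back `P` GIVEN BY ITS
DEFINING EQUATION `P z t = (B₂ (ι₂ z) (ι₂ t), B₂ (ι₂ z) (wM (ι₂ t)))`, and a family `s` in `Sel` whose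
images lie in `D` (`…LiftPackage` outputs 10–11): `P ⟨s i, _⟩ ⟨s i', _⟩ = 0` and
`P ⟨wS (s i), _⟩ ⟨s i', _⟩ = 0` for all `i, i'`. [cite: McCallumLMS1991, §5 Thm. 5.4 (proof, p. 288)] -/
theorem isotropy_of_images (Sel : AddSubgroup S) (wS : S →+ S) (hwSel : ∀ s ∈ Sel, wS s ∈ Sel)
    (τ : S →+ Q) (ι : M →+ Q) (hι : Function.Injective ι) (ι₂ : Sel →+ M)
    (hι₂ : ∀ z : Sel, ι (ι₂ z) = τ z) (wM : M →+ M) (hw : ∀ x, wM (wM x) = -x - wM x) (T : Set M)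
    (B₂ : M →+ M →+ R)
    (hiso : ∀ a ∈ AddSubgroup.closure (T ∪ wM '' T), ∀ b ∈ AddSubgroup.closure (T ∪ wM '' T),
      B₂ a b = 0)
    (P : Sel →+ Sel →+ R × R) (hP : ∀ z t, P z t = (B₂ (ι₂ z) (ι₂ t), B₂ (ι₂ z) (wM (ι₂ t))))
    (s : ℕ → S) (hsel : ∀ i, s i ∈ Sel)
    (himg : ∀ i, ∃ a ∈ AddSubgroup.closure (T ∪ wM '' T), τ (s i) = ι a ∧ τ (wS (s i)) = ι (wM a)) :
    ∀ i i', P ⟨s i, hsel i⟩ ⟨s i', hsel i'⟩ = 0 ∧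
      P ⟨wS (s i), hwSel _ (hsel i)⟩ ⟨s i', hsel i'⟩ = 0 := by
  -- the Selmer classes map INTO `D`: `ι₂ ⟨s i⟩ = a_i`, `ι₂ ⟨wS (s i)⟩ = wM a_i`
  have hval : ∀ i, ∃ a ∈ AddSubgroup.closure (T ∪ wM '' T),
      ι₂ ⟨s i, hsel i⟩ = a ∧ ι₂ ⟨wS (s i), hwSel _ (hsel i)⟩ = wM a := by
    intro i
    obtain ⟨a, ha, h1, h2⟩ := himg i
    refine ⟨a, ha, hι ?_, hι ?_⟩
    · rw [hι₂]; exact h1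
    · rw [hι₂]; exact h2
  intro i i'
  obtain ⟨a, ha, ha1, ha2⟩ := hval i
  obtain ⟨b, hb, hb1, -⟩ := hval i'
  have hwb : wM b ∈ AddSubgroup.closure (T ∪ wM '' T) := w_mem_closure_union_image wM hw T hb
  have hwa : wM a ∈ AddSubgroup.closure (T ∪ wM '' T) := w_mem_closure_union_image wM hw T ha
  refine ⟨?_, ?_⟩
  · rw [hP, ha1, hb1, hiso a ha b hb, hiso a ha (wM b) hwb, Prod.mk_zero_zero]
  · rw [hP, ha2, hb1, hiso (wM a) hwa b hb, hiso (wM a) hwa (wM b) hwb, Prod.mk_zero_zero]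

end LiftIsotropy

end Summit.BirchSwinnertonDyer.BirchSwinnertonDyer.Theorems.SylvesterTwoCoupledTelescope
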